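import Mathlib.RingTheory.DiscreteValuationRing.Basic
import Mathlib.Algebra.Module.Torsion.Prod
import Mathlib.LinearAlgebra.Span.Basic
import Mathlib.GroupTheory.OrderOfElement
import Mathlib.NumberTheory.Padics.PadicVal.Basic
import HarnessLib

/-!
# Pasten 2024, Thm. 10.1 / 10.3 (the `p`-adic valuation of the Manin constant): the valuation game
# of §§10.2–10.6 in abstract form

Topic `NumberTheory/Automorphic`; a proofs-only companion (theorems only: no definition, no named
fact, nothing restated; D-0026) of `ShimuraCurveRibetTakahashi.lean` and
`ShimuraCurveRibetTakahashiProofs.lean`, written by the seat of the named fact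
`Literature.NumberTheory.Automorphic.PastenShimura2024_cor_10_2` (H. Pasten, *Shimura curves and
the abc conjecture*, J. Number Theory 254 (2024) = arXiv:1705.09251, Cor. 10.2 p. 33: the Manin
constant of optimal elliptic curves semistable away from `S` is bounded in terms of `S`). That
corollary is, in the tree, reduced to Pasten's Thm. 10.1 (`v_p(c_f) ≤ μ_{S,p}`) and Mazur's
Cor. 4.1 (`PastenShimura2024_cor_10_2_holds_of`, `ShimuraCurveRibetTakahashiProofs.lean`); Thm. 10.1
is Thm. 10.3 (`N = pⁿm`, `2 ≤ n ≤ 8`, auxiliary prime `ℓ ∈ {5, 7}`) whose proof, §§10.2–10.6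
(pp. 33–37), is played on objects Mathlib does not have: the regular `ℤ_(p)`-models `𝒳_m` of the
curves `X_{U₀(pⁿm) ∩ U₁(ℓ)}` and their dualizing sheaves, the Néron models `𝒥_m`, `𝒜`, `𝒞` of
`J_m = Jac(X_m)`, of `A` and of the `J_m`-optimal quotients, the degeneracy maps `α, β`, the Hecke
algebra and the Petersson projection `P_χ`. What the printed proof does with these objects is a
finite piece of commutative algebra over `R = ℤ_(p)` — Pasten's calculus of the invariant
`v(M) = min {k : pᵏ M_tor = 0}` of §10.2 — and THIS FILE PROVES THAT ALGEBRA FOR ABSTRACT MODULES,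
in the order of the source, each statement recording the dictionary, so that the printed proof is
mirrored down to its geometric inputs (which appear as hypotheses on abstract modules and maps;
nothing is assumed about modular curves). The precedent is
`EllipticCurves/ModularCurveManinSemistableLieGameProofs.lean` (Česnavičius's Lie-algebra game).

## Dictionary (source §10 ⟶ this file)

`R` is a domain with a non-unit `ϖ ≠ 0` (`R = ℤ_(p)`, `ϖ = p`; a DVR where §10.6 needs it). For a
torsion-free `R`-module `H` and `y ∈ H`, Pasten's `v(H/R·y)` (the `p`-exponent of the torsion of
`H/Ry`, §10.2) is the largest `k` with `y ∈ ϖᵏH`; so "`v(H/Ry) ≥ k`" is rendered `∃ h, y = ϖ^k • h`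
and "`v(H/Ry) ≤ k`" is rendered "`ϖⁿ z = ϖ^i h ⇒ i ≤ n`"; "`x` primitive" (§10.2) is
`∀ x', x ≠ ϖ • x'`; for a torsion module `T`, "`v(T) ≤ k`" is "`ϖᵏ T = 0`", and for an integer
`d`, "`v_p(d) ≤ v(T)`" (as in "`d` divides the exponent of `T`") is rendered locally at `p` as
"`d ∣ e` for every scalar `e` killing `T`".

* `H' = H⁰(𝒥_m, Ω¹) ≅ H⁰(𝒳_m, ω_m)` ((EqDuality) p. 34), `H = H⁰(𝒳_m^∞, ω_m) = S_m(ℤ) ⊗ R`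
  (`q`-expansion principle, p. 35), `j = j_m^• : H' → H` injective, and Thm. 10.4 (Conrad,
  (EqConrad)): `v(coker j_m^•) ≤ B`, i.e. `ϖ^B H ⊆ j(H')` (`hB`).
* `c = v_p(c_f) = v(H⁰(𝒳_{0,m}^∞, Ω¹)/R·φ^•ω)` (§10.4) enters only through (EqcAalpha)/(EqcAbeta):
  `(φα)^•ω, (φβ)^•ω ∈ ϖ^c H` (`smul_pow_mem_of_map` is the one-line reason: `α^•`, `β^•` are linear).
* §10.5 (`ℓ ∣ m`): `L = H⁰(𝒞, Ω¹) = R ω̃`, `ι = θ^• : L → H'`, `ρ = (θ^∨)^• : H' → L`,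
  `ρ ∘ ι = d = deg φ_m` (`θθ^∨ = [deg φ_m]`), `X = H'^χ = R x₀` (saturated, rank one since `f` is
  new for `U₀(pⁿm) ∩ U₁(ℓ)`), `P = P_χ : H' → Y = P_χ(H') = R y₀`, `ρ = g ∘ P`
  (`ker (θ^∨)^• = (H'^χ)^⊥ = ker P_χ`), `XS = S^χ`, `XSp = (S^χ)^⊥` inside `H = S_m(ℤ) ⊗ R` with
  `j(H'^χ) ⊆ S^χ`, `j((H'^χ)^⊥) ⊆ (S^χ)^⊥`, and [ARSdeg] Thm. 3.6 (a) with the `q`-expansion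
  principle: `deg φ_m` divides the congruence exponent, locally "`d ∣ e` whenever `e` kills
  `H/((S^χ)^⊥ + S^χ)`" (`hARS`); `π^•ω = p^a ω̃` with `a ≤ v_p(deg π)`.
  Result `le_of_valuationGame_new`: `c ≤ 2B + a` — the printed
  "`v_p(c_f) ≤ 2 v(coker(j_m^•)) + v_p(deg π)`" (p. 36, line before §10.6).
* Lemma 10.5 (`ℓ ∤ m`): additive groups of geometric points, `πv = π^∨`, `θv = θ^∨`,
  `σ = σ^*` with `σ_* σ^* = [deg σ]`, `e₀ = α₀^* + β₀^*`, `qq = q^∨ × q^∨`; Ihara's lemma in Ribet's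
  form with `T_r = a_r(A)` on `A × A`: `(r + 1 - a_r)` kills `ker(e₀ ∘ qq)` (`hEis`); Lemma 6.7
  (= (LemmaCongIneff)): some admissible `r` has `p^β ∤ r + 1 - a_r` (`h67`). Result
  `pow_smul_eq_zero_of_lemma_10_5`: `p^(β-1+v_p(deg σ))` kills the `p`-primary torsion of `ker π^∨`
  (and of `ker π` by Cartier duality, an input), and `pow_padicValNat_dvd_of_lemma_10_5`:
  (EqDegCompar) `v_p(deg φ deg α) ≤ v_p(ñ_Σ) + 2u`.
* §10.6 (`ℓ ∤ m`): `H⁰(𝒜², Ω¹) = R ω₁ ⊕ R ω₂` rendered as `R × R`, `τ = τ^• : R × R → H'^χ = X₂` with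
  torsion cokernel (`hτ`), `ρ₂ = (τ^∨)^•`, `ρ₂ ∘ τ = D = deg φ · deg α` ((EqTauAsMult)),
  `ρ₂ = g₂ ∘ P_χ`; `P_χ(H')/H'^χ` torsion (`hκ`); (EqDegCompar): `D ∣ ñ_Σ ϖ^{2u}` (`hD`);
  [ARSdeg] for `Σ`: `ñ_Σ ∣ e` whenever `e` kills `H/((S^χ)^⊥ + S^χ)` (`hARS`);
  `(τ j_m)^• ω₁ = (φα)^•ω`, `(τ j_m)^• ω₂ = (φβ)^•ω ∈ ϖ^c H`.
  Result `le_of_valuationGame_old`: `c ≤ 2B + 2u`.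

Deviations from the printed road, each noted in place: (EqM1)/(EqSecondAux) are obtained by
chasing `ω̃` through `ρ = g ∘ P` directly (the source first replaces `H'/(H'^χ)^⊥` by `P_χ(H')`);
the element `ω̃₀` of §10.6 is produced without elementary divisors (a `y` with `ϖ^{e-1} y ∉ P(H'^χ)`
for the minimal `e` is automatically primitive, and so is its partner `z ∈ H'^χ`; the injectivity
of `P_χ` on `H'^χ` turns out not to be needed for the inequality); and (EqFinalClaim), which the
source reads off vanishing orders along the irreducible special fibre of `𝒳_m^∞`, is here the
ultrametric property of divisibility: `(φα)^•ω, (φβ)^•ω ∈ ϖ^c H ⇒ r₁(φα)^•ω + r₂(φβ)^•ω ∈ ϖ^c H`.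

What is NOT here: any of the geometric inputs (Thm. 10.4; the models and Néron models; optimal
quotients and `θθ^∨ = [deg]`; Ihara's lemma; [ARSdeg]; the `q`-expansion principle; Lemma 6.7;
`v_p(c_f)` as a vanishing order), and the assembly of Thm. 10.1 from Thm. 10.3 over `2 ≤ n ≤ 8`
with the classical results at `v_p(N) ≤ 1` (that assembly is `ShimuraCurveRibetTakahashiProofs`).

## References

* H. Pasten, *Shimura curves and the abc conjecture*, J. Number Theory 254 (2024) 214–335 =
  arXiv:1705.09251, §10 pp. 33–37 (Thm. 10.1, Cor. 10.2, Thm. 10.3, Thm. 10.4, Lemma 10.5) and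
  Lemma 6.7 p. 22. [PastenShimura2024]
-/

namespace Literature.NumberTheory.Automorphic.ManinValuation

open Function Module

variable {R : Type*} [CommRing R] {ϖ : R}

/-! ### §10.2: the calculus of `v(M)` in membership form -/

section Calculus

variable {H H' : Type*} [AddCommGroup H] [Module R H] [AddCommGroup H'] [Module R H']

/-- (EqcAalpha)/(EqcAbeta), p. 34: a linear map (`α^•`, `β^•`, which restrict to
`𝒳_m^∞ → 𝒳_{0,m}^∞` because `α`, `β` fix the cusp `i∞`) does not decrease divisibility by `ϖ`:
`y ∈ ϖ^c H₀ ⇒ f y ∈ ϖ^c H`, i.e. `v(H₀/R·y) ≤ v(H/R·f(y))` for torsion-free `H₀`, `H`.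
[cite: PastenShimura2024, §10.4 (EqcAalpha), (EqcAbeta) p. 34] -/
theorem smul_pow_mem_of_map (f : H' →ₗ[R] H) {y : H'} {c : ℕ} (hy : ∃ h, y = ϖ ^ c • h) :
    ∃ h, f y = ϖ ^ c • h := by
  obtain ⟨h, rfl⟩ := hy
  exact ⟨f h, map_smul f _ _⟩

/-- Cancellation of `ϖ^a` in a torsion-free module: `ϖ^a y = ϖ^c h` with `a ≤ c` gives
`y = ϖ^(c-a) h` — the step "`v(H/R·p^a y) = v(H/R·y) + a`" of §10.5 ((EqRed1), with
`(φα)^•ω = p^a φ_m^• ω̃`). [cite: PastenShimura2024, §10.5 p. 35] -/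
theorem eq_pow_sub_smul_of_pow_smul_eq [IsDomain R] [IsTorsionFree R H] (hϖ : ϖ ≠ 0) {y h : H}
    {a c : ℕ} (hac : a ≤ c) (hy : ϖ ^ a • y = ϖ ^ c • h) : y = ϖ ^ (c - a) • h := by
  apply smul_right_injective H (pow_ne_zero a hϖ)
  dsimp only
  rw [hy, ← mul_smul, ← pow_add, Nat.add_sub_cancel' hac]

/-- A primitive element bounds divisibility: if `z ∉ ϖ H` and `ϖ^n z = ϖ^i h` then `i ≤ n`
(`v(H/R·ϖⁿz) = n` for primitive `z`, §10.2). [cite: PastenShimura2024, §10.2 p. 34] -/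
theorem le_of_pow_smul_eq_pow_smul_of_primitive [IsDomain R] [IsTorsionFree R H] (hϖ : ϖ ≠ 0)
    {z h : H} {n i : ℕ} (hz : ∀ z' : H, z ≠ ϖ • z') (h_eq : ϖ ^ n • z = ϖ ^ i • h) : i ≤ n := by
  by_contra hlt
  push Not at hlt
  have h1 : z = ϖ ^ (i - n) • h := eq_pow_sub_smul_of_pow_smul_eq hϖ hlt.le h_eq
  obtain ⟨k, hk⟩ := Nat.exists_eq_add_of_lt hlt
  refine hz (ϖ ^ k • h) ?_
  rw [h1, hk, show n + k + 1 - n = k + 1 by omega, pow_succ', mul_smul]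

/-- **Thm. 10.4 (Conrad) transfers divisibility from `H⁰(𝒳_m^∞, ω_m)` back to `H⁰(𝒥_m, Ω¹)` at
the cost of `ϖ^B`:** if `ϖ^B H ⊆ j(H')` (`v(coker j) ≤ B`), `j` is injective and `j(y) = ϖ^i h`, then
`ϖ^B y = ϖ^i h'` for some `h' ∈ H'` — the inequality
"`v(H/R·j(y)) ≤ v(coker(j_m^•)) + v(H'/R·y)`" used before (EqRed1) and in (EqFirstAux)
("because `j_m^•` is injective"). [cite: PastenShimura2024, §10.5 p. 35 and (EqFirstAux) p. 36] -/
theorem exists_pow_smul_eq_of_coker (j : H' →ₗ[R] H) (hj : Injective j) {B : ℕ}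
    (hB : ∀ h : H, ∃ h' : H', j h' = ϖ ^ B • h) {y : H'} {h : H} {i : ℕ}
    (hy : j y = ϖ ^ i • h) : ∃ h' : H', ϖ ^ B • y = ϖ ^ i • h' := by
  obtain ⟨h', hh'⟩ := hB h
  refine ⟨h', hj ?_⟩
  rw [map_smul, hy, smul_comm, ← hh', map_smul]

/-- **The chain of p. 35 (from the congruence module of `H'` to that of `S = H`):** if a scalar
`e` kills `H'/(K ⊔ X)` (`K = (H'^χ)^⊥ = ker P_χ`, `X = H'^χ`), `ϖ^B H ⊆ j(H')` (Thm. 10.4) and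
`j(X) ⊆ S^χ`, `j(K) ⊆ (S^χ)^⊥`, then `e ϖ^B` kills `H/((S^χ)^⊥ ⊔ S^χ)`: the printed
`v(S/((S^χ)^⊥ + S^χ)) ≤ v(H'/((H'^χ)^⊥ + H'^χ)) + v(coker(j_m^•))`.
[cite: PastenShimura2024, §10.5 p. 35 (display after [ARSdeg])] -/
theorem mul_pow_smul_mem_sup (j : H' →ₗ[R] H) {B : ℕ} (hB : ∀ h : H, ∃ h' : H', j h' = ϖ ^ B • h)
    {K X : Submodule R H'} {XSp XS : Submodule R H} (hjK : K.map j ≤ XSp) (hjX : X.map j ≤ XS)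
    {e : R} (he : ∀ m : H', e • m ∈ K ⊔ X) (h : H) : (e * ϖ ^ B) • h ∈ XSp ⊔ XS := by
  obtain ⟨m, hm⟩ := hB h
  obtain ⟨k, hk, x, hx, hsum⟩ := Submodule.mem_sup.mp (he m)
  rw [mul_smul, ← hm, ← map_smul, ← hsum, map_add]
  exact Submodule.add_mem_sup (hjK (Submodule.mem_map_of_mem (f := j) hk))
    (hjX (Submodule.mem_map_of_mem (f := j) hx))

end Calculus

/-! ### §10.5: the case `ℓ ∣ m` (`f` new for `U₀(pⁿm) ∩ U₁(ℓ)`) -/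

section NewCase

variable {H H' L Y : Type*} [AddCommGroup H] [Module R H] [AddCommGroup H'] [Module R H']
  [AddCommGroup L] [Module R L] [AddCommGroup Y] [Module R Y]

/-- **(EqM1), p. 35, in the sharp form `deg φ_m = s · t · r`.** Chase `ω̃` around the square
`R ω̃ —(deg φ_m)→ R ω̃`, `θ^• ↓`, `↑ (θ^∨)^•`, `H' —P_χ→ P_χ(H')`: with `θ^• ω̃ = s x₀`
(`x₀` a generator of `H'^χ`, so `v(H'/R·θ^•ω̃) = v(s)`), `P_χ x₀ = t y₀` (`y₀` a generator of
`P_χ(H')`, so `v(P_χ(H')/H'^χ) = v(t)`) and `g y₀ = r ω̃`, one gets `d ω̃ = (s t r) ω̃`, hence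
`d = s t r` and in particular `v_p(deg φ_m) ≥ v(H'/R·θ^•ω̃) + v(P_χ(H')/H'^χ)`. (The source replaces
the corner `H'/(H'^χ)^⊥` by `P_χ(H')`; here `(θ^∨)^• = g ∘ P_χ` is the datum.)
[cite: PastenShimura2024, §10.5 (EqM1) p. 35] -/
theorem eq_mul_mul_of_chase [IsDomain R] [IsTorsionFree R L] {ι : L →ₗ[R] H'} {ρ : H' →ₗ[R] L}
    {d : R} (hρι : ρ ∘ₗ ι = d • LinearMap.id) {P : H' →ₗ[R] Y} {g : Y →ₗ[R] L} (hg : g ∘ₗ P = ρ)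
    {ω : L} (hω : ω ≠ 0) {x₀ : H'} {y₀ : Y} {s t r : R} (hs : ι ω = s • x₀)
    (ht : P x₀ = t • y₀) (hr : g y₀ = r • ω) : d = s * t * r := by
  have e1 : ρ (ι ω) = d • ω := by
    simpa using LinearMap.congr_fun hρι ω
  have e2 : ρ (ι ω) = (s * t * r) • ω := by
    rw [← hg, LinearMap.comp_apply, hs, map_smul, ht, map_smul, map_smul, hr, smul_smul, smul_smul]
  exact smul_left_injective R hω (e1.symm.trans e2)

/-- **`t` kills the congruence module `H'/((H'^χ)^⊥ + H'^χ)`** when `P_χ(H') = R y₀` and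
`P_χ x₀ = t y₀` with `x₀ ∈ H'^χ` (the identification `H'/((H'^χ)^⊥ + H'^χ) ≅ P_χ(H')/H'^χ` of the
last line of the chain on p. 35, in the form that is used). [cite: PastenShimura2024, §10.5 p. 35] -/
theorem smul_mem_ker_sup (P : H' →ₗ[R] Y) {X : Submodule R H'} {x₀ : H'} (hx₀ : x₀ ∈ X) {y₀ : Y}
    (hY : ∀ y : Y, ∃ u : R, y = u • y₀) {t : R} (ht : P x₀ = t • y₀) (m : H') :
    t • m ∈ LinearMap.ker P ⊔ X := by
  obtain ⟨u, hu⟩ := hY (P m)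
  rw [Submodule.mem_sup]
  refine ⟨t • m - u • x₀, ?_, u • x₀, X.smul_mem u hx₀, sub_add_cancel _ _⟩
  rw [LinearMap.mem_ker, map_sub, map_smul, map_smul, hu, ht, smul_smul, smul_smul, mul_comm,
    sub_self]

/-- **Pasten 2024, §10.5 — the case `ℓ ∣ m` of Thm. 10.3, its commutative algebra in one
statement: `v_p(c_f) ≤ 2 v(coker(j_m^•)) + a`.** Data and hypotheses (dictionary in the module
docstring): `j = j_m^•` injective with Conrad's bound `ϖ^B H ⊆ j(H')` (Thm. 10.4); `X = H'^χ = R x₀`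
saturated; `P = P_χ` into `Y = P_χ(H') = R y₀` with `P x₀ = t y₀`, `t ≠ 0` (`P_χ` is injective on
`H'^χ`); `ι = θ^•`, `ρ = (θ^∨)^• = g ∘ P` with `ρ ∘ ι = d = deg φ_m`; `L = H⁰(𝒞, Ω¹) = R ω̃`,
`θ^• ω̃ ∈ H'^χ`; `j(H'^χ) ⊆ S^χ`, `j(ker P_χ) ⊆ (S^χ)^⊥` and [ARSdeg] Thm. 3.6 (a) locally at `p`
(`hARS`); finally (EqcAalpha) with `π^• ω = p^a ω̃`: `p^a j(θ^• ω̃) = (φα)^• ω ∈ ϖ^c H` where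
`c = v_p(c_f)`. Conclusion `c ≤ 2B + a`. Proof as printed: (EqRed1) `c - a ≤ v(coker j) + v(s)`
(`exists_pow_smul_eq_of_coker`, saturation of `H'^χ`), (EqM1) `d = s t r` (`eq_mul_mul_of_chase`),
the chain `d ∣ t ϖ^B` (`smul_mem_ker_sup`, `mul_pow_smul_mem_sup`, `hARS`), whence `s ∣ ϖ^B` and
`ϖ^(c-a) ∣ ϖ^(2B)`. [cite: PastenShimura2024, Thm. 10.3, case ℓ ∣ m (§10.5 pp. 35–36)] -/
theorem le_of_valuationGame_new [IsDomain R] [IsTorsionFree R H] [IsTorsionFree R H']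
    [IsTorsionFree R L] (hϖ : ¬IsUnit ϖ) (hϖ0 : ϖ ≠ 0)
    (j : H' →ₗ[R] H) (hj : Injective j) {B : ℕ} (hB : ∀ h : H, ∃ h' : H', j h' = ϖ ^ B • h)
    {X : Submodule R H'} {x₀ : H'} (hX : X = Submodule.span R {x₀}) (hx₀ : x₀ ≠ 0)
    (hXsat : ∀ (n : ℕ) (m : H'), ϖ ^ n • m ∈ X → m ∈ X)
    (P : H' →ₗ[R] Y) {y₀ : Y} (hY : ∀ y : Y, ∃ u : R, y = u • y₀) {t : R} (ht : P x₀ = t • y₀)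
    (ht0 : t ≠ 0)
    {ι : L →ₗ[R] H'} {ρ : H' →ₗ[R] L} {d : R} (hρι : ρ ∘ₗ ι = d • LinearMap.id)
    {g : Y →ₗ[R] L} (hg : g ∘ₗ P = ρ)
    {ω : L} (hω : ω ≠ 0) (hL : ∀ l : L, ∃ r : R, l = r • ω) (hιω : ι ω ∈ X)
    {XS XSp : Submodule R H} (hjX : X.map j ≤ XS) (hjK : (LinearMap.ker P).map j ≤ XSp)
    (hARS : ∀ e : R, (∀ h : H, e • h ∈ XSp ⊔ XS) → d ∣ e)
    {c a : ℕ} (hca : ∃ h : H, ϖ ^ a • j (ι ω) = ϖ ^ c • h) : c ≤ 2 * B + a := by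
  rcases le_or_gt c a with hle | hac
  · omega
  obtain ⟨h, hh⟩ := hca
  -- (EqRed1), first half: `j(θ^•ω̃) = ϖ^(c-a) h`, then Conrad: `ϖ^B θ^•ω̃ = ϖ^(c-a) h'`.
  have h1 : j (ι ω) = ϖ ^ (c - a) • h := eq_pow_sub_smul_of_pow_smul_eq hϖ0 hac.le hh
  obtain ⟨h', hh'⟩ := exists_pow_smul_eq_of_coker j hj hB h1
  -- saturation: `h' ∈ H'^χ`; coordinates on the generator `x₀`.
  have hh'X : h' ∈ X := hXsat (c - a) h' (hh' ▸ X.smul_mem _ hιω)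
  obtain ⟨s, hs⟩ : ∃ s : R, s • x₀ = ι ω := by
    rw [hX, Submodule.mem_span_singleton] at hιω; exact hιω
  obtain ⟨s', hs'⟩ : ∃ s' : R, s' • x₀ = h' := by
    rw [hX, Submodule.mem_span_singleton] at hh'X; exact hh'X
  have h3 : ϖ ^ B * s = ϖ ^ (c - a) * s' := by
    apply smul_left_injective R hx₀
    dsimp only
    rw [mul_smul, mul_smul, hs, hs', hh']
  -- (EqM1): `d = s t r`.
  obtain ⟨r, hr⟩ := hL (g y₀)
  have h4 : d = s * t * r := eq_mul_mul_of_chase hρι hg hω hs.symm ht hr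
  -- the chain of p. 35 with [ARSdeg]: `d ∣ t ϖ^B`.
  have hx₀X : x₀ ∈ X := by rw [hX]; exact Submodule.mem_span_singleton_self x₀
  have h6 : d ∣ t * ϖ ^ B :=
    hARS _ (mul_pow_smul_mem_sup j hB hjK hjX (smul_mem_ker_sup P hx₀X hY ht))
  -- arithmetic in `R`: `ϖ^(c-a) ∣ ϖ^(2B)`.
  have h7 : ϖ ^ (c - a) ∣ ϖ ^ (2 * B) := by
    obtain ⟨q, hq⟩ := h6
    have hB' : ϖ ^ B = s * r * q := by
      apply mul_left_cancel₀ ht0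
      rw [hq, h4]; ring
    refine ⟨s' * r * q, ?_⟩
    rw [two_mul, pow_add]
    linear_combination (ϖ ^ B) * hB' + (r * q) * h3
  have h8 := (pow_dvd_pow_iff hϖ0 hϖ).mp h7
  omega

/-- **§10.5, printed form:** with `a ≤ v_p(deg π)` (the exponent making `p^{-a} π^• ω` a Néron
differential on `𝒞` is at most `v_p(deg π)`, and `v_p(deg π) ≪_ℓ 1` because `deg π ∣ deg α ≤
[U(1) : U₁(ℓ)]`), `v_p(c_f) ≤ 2 v(coker(j_m^•)) + v_p(deg π)` — "note that the bound is
independent of `S`". [cite: PastenShimura2024, §10.5 p. 36 (last display before §10.6)] -/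
theorem le_of_valuationGame_new' {c a B vdegπ : ℕ} (h : c ≤ 2 * B + a) (ha : a ≤ vdegπ) :
    c ≤ 2 * B + vdegπ :=
  h.trans (by omega)

end NewCase

/-! ### Lemma 10.5: `p^u` kills the `p`-primary part of `ker π` (`u ≪_{S,p,ℓ} 1`) -/

section Lemma105

variable {A J₀ J Sv : Type*} [AddCommGroup A] [AddCommGroup J₀] [AddCommGroup J]
  [AddCommGroup Sv]

/-- **The Eisenstein step of Lemma 10.5.** If for every admissible `r` the integer `w r - a r`
(`w r = r + 1`: `T_r` acts as `r + 1` on the Eisenstein kernel `ker(α₀^* + β₀^*)` by Ihara's lemma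
in Ribet's formulation, and as `a_r(A)` on `A × A`) kills `x`, and some admissible `r` has
`p^β ∤ w r - a r` (Lemma 6.7 (ii)), then an `x` of `p`-power order has order `< p^β`:
`p^(β-1) x = 0`. [cite: PastenShimura2024, Lemma 10.5 (proof) p. 36, with Lemma 6.7 p. 22] -/
theorem pow_smul_eq_zero_of_eisenstein {p : ℕ} (hp : p.Prime) {β : ℕ} {ι : Type*} {w a : ι → ℤ}
    {x : A} (hT : ∀ i, (w i - a i) • x = 0) (h67 : ∃ i, ¬((p : ℤ) ^ β ∣ w i - a i))
    (hx : ∃ k : ℕ, p ^ k • x = 0) : p ^ (β - 1) • x = 0 := by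
  obtain ⟨i, hi⟩ := h67
  obtain ⟨k, hk⟩ := hx
  -- the order of `x` is `p^e` with `p^e ∣ w i - a i`, hence `e < β`.
  have hord : addOrderOf x ∣ p ^ k := addOrderOf_dvd_of_nsmul_eq_zero hk
  obtain ⟨e, -, he⟩ := (Nat.dvd_prime_pow hp).mp hord
  have hdiv : (p : ℤ) ^ e ∣ w i - a i := by
    have := addOrderOf_dvd_iff_zsmul_eq_zero.mpr (hT i)
    rw [he] at this
    exact_mod_cast this
  have heβ : e < β := by
    by_contra hle
    push Not at hle
    exact hi ((pow_dvd_pow (p : ℤ) hle).trans hdiv)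
  have : addOrderOf x ∣ p ^ (β - 1) := by
    rw [he]; exact pow_dvd_pow p (by omega)
  exact addOrderOf_dvd_iff_nsmul_eq_zero.mp this

/-- **Kernel of a composite, `p`-primary exponents multiply** (used twice in the proof of Lemma 10.5
and again for (EqDegCompar)): if `n_g` kills the `p`-primary torsion of `ker g` and `n_f` kills the
`p`-primary torsion of `ker f`, then `n_f n_g` kills the `p`-primary torsion of `ker (f ∘ g)`.
[cite: PastenShimura2024, Lemma 10.5 (proof) p. 36] -/
theorem mul_smul_eq_zero_of_comp {B C : Type*} [AddCommGroup B] [AddCommGroup C] (g : A →+ B)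
    (f : B →+ C) {p n_f n_g : ℕ}
    (hg : ∀ x : A, g x = 0 → (∃ k : ℕ, p ^ k • x = 0) → n_g • x = 0)
    (hf : ∀ y : B, f y = 0 → (∃ k : ℕ, p ^ k • y = 0) → n_f • y = 0)
    {x : A} (hx : f (g x) = 0) (hxp : ∃ k : ℕ, p ^ k • x = 0) : (n_f * n_g) • x = 0 := by
  obtain ⟨k, hk⟩ := hxp
  have h1 : n_f • g x = 0 := hf (g x) hx ⟨k, by rw [← map_nsmul, hk, map_zero]⟩
  have h2 : g (n_f • x) = 0 := by rw [map_nsmul, h1]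
  have h3 : n_g • (n_f • x) = 0 := hg _ h2 ⟨k, by rw [smul_comm, hk, smul_zero]⟩
  rwa [smul_smul, mul_comm] at h3

/-- **Pasten 2024, Lemma 10.5, its group theory.** In the commutative diagram of p. 36
(`θ^∨ ∘ π^∨ = σ^* ∘ (α₀^* + β₀^*) ∘ (q^∨ × q^∨)` as maps `A × A → J_m`): `deg σ` kills `ker σ^*`
(`σ_* σ^* = [deg σ]`), so `p^v`, `v = v_p(deg σ)`, kills its `p`-primary part (`hσ`); on
`Z = ker((α₀^* + β₀^*) ∘ (q^∨ × q^∨))` every `w r - a r` acts as `0` (Ihara–Ribet: the kernel of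
`α₀^* + β₀^*` is Eisenstein; `T_r = a_r` on `A × A`) and some admissible `r` has `p^β ∤ w r - a r`
(Lemma 6.7). Then `p^(β - 1 + v)` kills the `p`-primary torsion of `ker π^∨` (and, by Cartier
duality, of `ker π` — an input not formalised here): `u = β - 1 + v_p(deg σ)`. (The source also
uses that `θ^∨` and `q^∨ × q^∨` are injective, to identify `ker π^∨`; for the bound the inclusion
`ker π^∨ ⊆ ker(θ^∨ π^∨)` suffices.) [cite: PastenShimura2024, Lemma 10.5 p. 36] -/
theorem pow_smul_eq_zero_of_lemma_10_5 {p : ℕ} (hp : p.Prime) {β v : ℕ}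
    (qq : A →+ J₀) (e₀ : J₀ →+ J₀) (σ : J₀ →+ J) (θv : Sv →+ J)
    (πv : A →+ Sv) (hcomm : θv.comp πv = σ.comp (e₀.comp qq))
    (hσ : ∀ y : J₀, σ y = 0 → (∃ k : ℕ, p ^ k • y = 0) → p ^ v • y = 0)
    {ι : Type*} {w a : ι → ℤ} (hEis : ∀ x : A, e₀ (qq x) = 0 → ∀ i, (w i - a i) • x = 0)
    (h67 : ∃ i, ¬((p : ℤ) ^ β ∣ w i - a i))
    {x : A} (hx : πv x = 0) (hxp : ∃ k : ℕ, p ^ k • x = 0) : p ^ (β - 1 + v) • x = 0 := by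
  have hx' : σ ((e₀.comp qq) x) = 0 := by
    have := DFunLike.congr_fun hcomm x
    simp only [AddMonoidHom.coe_comp, comp_apply] at this
    rw [AddMonoidHom.comp_apply, ← this, hx, map_zero]
  have key := mul_smul_eq_zero_of_comp (e₀.comp qq) σ (p := p) (n_f := p ^ v)
    (n_g := p ^ (β - 1))
    (fun y hy hyp ↦ pow_smul_eq_zero_of_eisenstein hp (hEis y hy) h67 hyp) hσ hx' hxp
  rwa [← pow_add, add_comm] at key

/-- **(EqDegCompar), upper bound, p. 36:** from `τ τ^∨ = π (θθ^∨) π^∨ = [D]` on `A × A`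
(`D = deg φ · deg α`, (EqTauAsMult)), `p^u` killing the `p`-primary parts of `ker π` and `ker π^∨`
(Lemma 10.5) and `ñ = ñ_Σ` killing `ker(θθ^∨)` (definition of the modular exponent), the integer
`ñ p^(2u)` kills the `p`-primary part of `ker [D] = (A × A)[D]`; as the latter contains a point of
exact order `p^(v_p(D))`, `p^(v_p(D)) ∣ ñ p^(2u)`, i.e. `v_p(deg φ · deg α) ≤ v_p(ñ_Σ) + 2u`.
[cite: PastenShimura2024, §10.6 (EqDegCompar) p. 36] -/
theorem pow_padicValNat_dvd_of_lemma_10_5 {p : ℕ} {G Sg : Type*} [AddCommGroup G]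
    [AddCommGroup Sg] (πv : G →+ Sv) (M : Sv →+ Sg) (π : Sg →+ G) {u ñ D : ℕ}
    (hπv : ∀ x : G, πv x = 0 → (∃ k : ℕ, p ^ k • x = 0) → p ^ u • x = 0)
    (hπ : ∀ z : Sg, π z = 0 → (∃ k : ℕ, p ^ k • z = 0) → p ^ u • z = 0)
    (hM : ∀ y : Sv, M y = 0 → ñ • y = 0)
    (hD : ∀ x : G, π (M (πv x)) = 0 ↔ D • x = 0)
    {P : G} (hP : addOrderOf P = p ^ padicValNat p D) :
    p ^ padicValNat p D ∣ ñ * p ^ (2 * u) := by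
  have hPD : D • P = 0 := by
    rw [← addOrderOf_dvd_iff_nsmul_eq_zero, hP]; exact pow_padicValNat_dvd
  have hker : π (M (πv P)) = 0 := (hD P).mpr hPD
  have hPp : ∃ k : ℕ, p ^ k • P = 0 :=
    ⟨padicValNat p D, by rw [← hP]; exact addOrderOf_nsmul_eq_zero P⟩
  have step := mul_smul_eq_zero_of_comp πv (π.comp M) (p := p) hπv
    (fun y hy hyp ↦ mul_smul_eq_zero_of_comp M π (p := p) (fun y' hy' _ ↦ hM y' hy') hπ hy hyp)
    hker hPp
  have := addOrderOf_dvd_of_nsmul_eq_zero step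
  rw [hP] at this
  calc p ^ padicValNat p D ∣ p ^ u * ñ * p ^ u := this
    _ = ñ * p ^ (2 * u) := by ring

end Lemma105

/-! ### §10.6: the case `ℓ ∤ m` (`f` old for `U₀(pⁿm) ∩ U₁(ℓ)`, `dim H⁰(J_m, Ω¹)^χ = 2`) -/

section OldCase

variable {H H' Y : Type*} [AddCommGroup H] [Module R H] [AddCommGroup H'] [Module R H']
  [AddCommGroup Y] [Module R Y]

/-- **(EqSecondAux), p. 36, the chase.** For `ω̃ ∈ H⁰(𝒜², Ω¹) = R × R`: if `τ^• ω̃ = ϖ^k z` and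
`P_χ z = ϖ^E y`, then `D ω̃ = (ττ^∨)^• ω̃ = g₂ (P_χ (τ^• ω̃)) ∈ ϖ^(k+E) (R × R)`; when `ω̃` is primitive
(a coordinate is a unit) this gives `ϖ^(k+E) ∣ D`, the printed
`v_p(deg φ deg α) ≥ v(H'/R·τ^•ω̃) + v(P_χ(H')/(H'^χ ∩ ℚ τ^•ω̃))`.
[cite: PastenShimura2024, §10.6 (EqSecondAux) p. 36] -/
theorem pow_dvd_of_chase₂ {τ : (R × R) →ₗ[R] H'} {ρ₂ : H' →ₗ[R] (R × R)} {D : R}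
    (hρτ : ρ₂ ∘ₗ τ = D • LinearMap.id) {P : H' →ₗ[R] Y} {g₂ : Y →ₗ[R] (R × R)}
    (hg₂ : g₂ ∘ₗ P = ρ₂) {ω : R × R} (hω : IsUnit ω.1 ∨ IsUnit ω.2) {z : H'} {y : Y} {k E : ℕ}
    (hz : τ ω = ϖ ^ k • z) (hy : P z = ϖ ^ E • y) : ϖ ^ (k + E) ∣ D := by
  have e1 : ρ₂ (τ ω) = D • ω := by simpa using LinearMap.congr_fun hρτ ω
  have e2 : ρ₂ (τ ω) = ϖ ^ (k + E) • g₂ y := by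
    rw [← hg₂, LinearMap.comp_apply, hz, map_smul, hy, map_smul, map_smul, smul_smul, ← pow_add]
  have e3 : D • ω = ϖ ^ (k + E) • g₂ y := e1.symm.trans e2
  rcases hω with hu | hu
  · have h := congrArg Prod.fst e3
    simp only [Prod.smul_fst, smul_eq_mul] at h
    refine ⟨(g₂ y).1 * ↑hu.unit⁻¹, ?_⟩
    rw [← mul_assoc, ← h, mul_assoc, IsUnit.mul_val_inv, mul_one]
  · have h := congrArg Prod.snd e3
    simp only [Prod.smul_snd, smul_eq_mul] at h
    refine ⟨(g₂ y).2 * ↑hu.unit⁻¹, ?_⟩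
    rw [← mul_assoc, ← h, mul_assoc, IsUnit.mul_val_inv, mul_one]

/-- **Primitive decomposition in `H⁰(𝒜², Ω¹) = R ω₁ ⊕ R ω₂` over a DVR:** every non-zero
`l ∈ R × R` is `ϖ^i ω̃₀` with `ω̃₀ = r₁ ω₁ + r₂ ω₂`, "at least one of them a unit" (p. 37).
[cite: PastenShimura2024, §10.6 p. 37] -/
theorem exists_eq_pow_smul_primitive [IsDomain R] [IsDiscreteValuationRing R] (hϖ : Irreducible ϖ)
    {l : R × R} (hl : l ≠ 0) :
    ∃ (i : ℕ) (ω : R × R), l = ϖ ^ i • ω ∧ (IsUnit ω.1 ∨ IsUnit ω.2) := by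
  obtain ⟨l₁, l₂⟩ := l
  rcases eq_or_ne l₁ 0 with h1 | h1
  · have h2 : l₂ ≠ 0 := by
      rintro rfl
      exact hl (Prod.ext h1 rfl)
    obtain ⟨n, v, hv⟩ := IsDiscreteValuationRing.eq_unit_mul_pow_irreducible h2 hϖ
    refine ⟨n, ((0 : R), (v : R)), Prod.ext ?_ ?_, Or.inr v.isUnit⟩
    · simp [h1]
    · simp [hv, mul_comm]
  rcases eq_or_ne l₂ 0 with h2 | h2
  · obtain ⟨n, v, hv⟩ := IsDiscreteValuationRing.eq_unit_mul_pow_irreducible h1 hϖ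
    refine ⟨n, ((v : R), (0 : R)), Prod.ext ?_ ?_, Or.inl v.isUnit⟩
    · simp [hv, mul_comm]
    · simp [h2]
  obtain ⟨n₁, v₁, hv₁⟩ := IsDiscreteValuationRing.eq_unit_mul_pow_irreducible h1 hϖ
  obtain ⟨n₂, v₂, hv₂⟩ := IsDiscreteValuationRing.eq_unit_mul_pow_irreducible h2 hϖ
  rcases le_or_gt n₁ n₂ with h | h
  · obtain ⟨e, rfl⟩ := Nat.exists_eq_add_of_le h
    refine ⟨n₁, ((v₁ : R), (v₂ : R) * ϖ ^ e), Prod.ext ?_ ?_, Or.inl v₁.isUnit⟩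
    · simp only [Prod.smul_fst, smul_eq_mul, hv₁]; ring
    · simp only [Prod.smul_snd, smul_eq_mul, hv₂]; ring
  · obtain ⟨e, rfl⟩ := Nat.exists_eq_add_of_le h.le
    refine ⟨n₂, ((v₁ : R) * ϖ ^ e, (v₂ : R)), Prod.ext ?_ ?_, Or.inr v₂.isUnit⟩
    · simp only [Prod.smul_fst, smul_eq_mul, hv₁]; ring
    · simp only [Prod.smul_snd, smul_eq_mul, hv₂]; ring

/-- **Pasten 2024, §10.6 — the case `ℓ ∤ m` of Thm. 10.3, its commutative algebra in one
statement: `v_p(c_f) ≤ 2 v(coker(j_m^•)) + 2u`.** Data and hypotheses (dictionary in the module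
docstring): `j = j_m^•` injective with Conrad's `ϖ^B H ⊆ j(H')`; `X₂ = H'^χ` saturated; `P = P_χ`
with `P_χ(H')/H'^χ` torsion (`hκ`, valid for `Y = P_χ(H')`); `τ = τ^• : R × R = H⁰(𝒜², Ω¹) → H'`
with torsion cokernel over `H'^χ` (`hτ`); `ρ₂ = (τ^∨)^• = g₂ ∘ P_χ`, `ρ₂ ∘ τ = D = deg φ deg α`
((EqTauAsMult)); (EqDegCompar) `D ∣ ñ_Σ ϖ^(2u)` (Lemma 10.5, `pow_padicValNat_dvd_of_lemma_10_5`);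
[ARSdeg] for `Σ` locally at `p` (`hARS`); (EqcAalpha), (EqcAbeta): `j(τ^• ω₁) = (φα)^•ω` and
`j(τ^• ω₂) = (φβ)^•ω` lie in `ϖ^c H`, `c = v_p(c_f)`. Conclusion `c ≤ 2B + 2u`. Proof as printed
(pp. 36–37): [ARSdeg] and the chain give `ñ ∣ ϖ^(e+B)` for the exponent `e` of `P_χ(H')/H'^χ`; an
`ω̃₀ = (r₁, r₂)` with a unit coordinate and `τ^•ω̃₀ = ϖ^k z`, `z` primitive, `P z ∈ ϖ^e Y` exists
(`exists_eq_pow_smul_primitive`; for `e = 0` the chase is run on `ω₁` instead); (EqSecondAux)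
`ϖ^(k+e) ∣ D` (`pow_dvd_of_chase₂`), so `k ≤ B + 2u` ((EqM2), (EqFinalBoundManin)); and
`(τ j_m)^• ω̃₀ = r₁ (φα)^•ω + r₂ (φβ)^•ω ∈ ϖ^c H` ((EqFinalClaim), ultrametric form), so Conrad and
the primitivity of `z` give `c ≤ B + k`.
[cite: PastenShimura2024, Thm. 10.3, case ℓ ∤ m (§10.6 pp. 36–37)] -/
theorem le_of_valuationGame_old [IsDomain R] [IsDiscreteValuationRing R] [IsTorsionFree R H]
    [IsTorsionFree R H'] [IsTorsionFree R Y] (hϖ : Irreducible ϖ)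
    (j : H' →ₗ[R] H) (hj : Injective j) {B : ℕ} (hB : ∀ h : H, ∃ h' : H', j h' = ϖ ^ B • h)
    {X₂ : Submodule R H'} (hXsat : ∀ (n : ℕ) (m : H'), ϖ ^ n • m ∈ X₂ → m ∈ X₂)
    (P : H' →ₗ[R] Y) (hκ : ∃ e : ℕ, ∀ y : Y, ∃ x ∈ X₂, P x = ϖ ^ e • y)
    (τ : (R × R) →ₗ[R] H') (hτ : ∀ x ∈ X₂, ∃ (n : ℕ) (l : R × R), τ l = ϖ ^ n • x)
    {ρ₂ : H' →ₗ[R] (R × R)} {D : R} (hρτ : ρ₂ ∘ₗ τ = D • LinearMap.id)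
    {g₂ : Y →ₗ[R] (R × R)} (hg₂ : g₂ ∘ₗ P = ρ₂)
    {XS XSp : Submodule R H} (hjX : X₂.map j ≤ XS) (hjK : (LinearMap.ker P).map j ≤ XSp)
    {ñ : R} (hARS : ∀ e : R, (∀ h : H, e • h ∈ XSp ⊔ XS) → ñ ∣ e)
    {u : ℕ} (hD : D ∣ ñ * ϖ ^ (2 * u))
    {c : ℕ} (hα : ∃ h : H, j (τ (1, 0)) = ϖ ^ c • h) (hβ : ∃ h : H, j (τ (0, 1)) = ϖ ^ c • h) :
    c ≤ 2 * B + 2 * u := by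
  have hϖ0 : ϖ ≠ 0 := hϖ.ne_zero
  -- the exponent `e` of `P_χ(H')/H'^χ`, chosen minimal; [ARSdeg] + the chain: `ñ ∣ ϖ^(e+B)`.
  classical
  obtain ⟨e, he, hemin⟩ : ∃ e : ℕ, (∀ y : Y, ∃ x ∈ X₂, P x = ϖ ^ e • y) ∧
      ∀ n < e, ¬∀ y : Y, ∃ x ∈ X₂, P x = ϖ ^ n • y :=
    ⟨Nat.find hκ, Nat.find_spec hκ, fun n hn ↦ Nat.find_min hκ hn⟩
  have hkill : ∀ m : H', ϖ ^ e • m ∈ LinearMap.ker P ⊔ X₂ := by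
    intro m
    obtain ⟨x, hx, hPx⟩ := he (P m)
    rw [Submodule.mem_sup]
    refine ⟨ϖ ^ e • m - x, ?_, x, hx, sub_add_cancel _ _⟩
    rw [LinearMap.mem_ker, map_sub, map_smul, hPx, sub_self]
  have hñ : ñ ∣ ϖ ^ e * ϖ ^ B := hARS _ (mul_pow_smul_mem_sup j hB hjK hjX hkill)
  -- hence `D ∣ ϖ^(e + B + 2u)` ((EqDegCompar) and [ARSdeg], i.e. (EqM2)).
  have hD' : D ∣ ϖ ^ (e + B + 2 * u) := by
    rw [pow_add, pow_add]
    exact hD.trans (mul_dvd_mul_right hñ _)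
  -- (EqFinalClaim), ultrametric form: `j (τ (r₁, r₂)) = r₁ (φα)^•ω + r₂ (φβ)^•ω ∈ ϖ^c H`.
  have hcomb : ∀ ω : R × R, ∃ h : H, j (τ ω) = ϖ ^ c • h := by
    rintro ⟨r₁, r₂⟩
    obtain ⟨hα', hhα⟩ := hα
    obtain ⟨hβ', hhβ⟩ := hβ
    refine ⟨r₁ • hα' + r₂ • hβ', ?_⟩
    have : ((r₁, r₂) : R × R) = r₁ • (1, 0) + r₂ • (0, 1) := by ext <;> simp
    rw [this, map_add, map_add, map_smul, map_smul, map_smul, map_smul, hhα, hhβ, smul_add,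
      smul_comm r₁, smul_comm r₂]
  -- (EqSecondAux) with (EqM2): for `ω̃` with a unit coordinate, `τ^•ω̃ = ϖ^k z` and `P z ∈ ϖ^e Y`
  -- give `ϖ^(k+e) ∣ D ∣ ϖ^(e+B+2u)`, so `k ≤ B + 2u` ((EqFinalBoundManin) for `ω̃₀`).
  have bound : ∀ (ω : R × R) (z : H') (y : Y) (k : ℕ), (IsUnit ω.1 ∨ IsUnit ω.2) →
      τ ω = ϖ ^ k • z → P z = ϖ ^ e • y → k ≤ B + 2 * u := by
    intro ω z y k hω hz hy
    have := (pow_dvd_pow_iff hϖ0 hϖ.not_isUnit).mp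
      ((pow_dvd_of_chase₂ hρτ hg₂ hω hz hy).trans hD')
    omega
  rcases Nat.eq_zero_or_pos e with he0 | hepos
  · -- `e = 0` (`P_χ(H') = P_χ(H'^χ)`): run the chase on `ω₁` itself.
    obtain ⟨h, hh⟩ := hα
    rcases le_or_gt c B with hcB | hcB
    · omega
    obtain ⟨h', hh'⟩ := exists_pow_smul_eq_of_coker j hj hB hh
    have h1 : τ (1, 0) = ϖ ^ (c - B) • h' := eq_pow_sub_smul_of_pow_smul_eq hϖ0 hcB.le hh'
    have := bound (1, 0) h' (P h') (c - B) (Or.inl isUnit_one) h1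
      (by rw [he0, pow_zero, one_smul])
    omega
  · -- `e = n + 1`: a `y` with `ϖ^n y ∉ P(H'^χ)` and `z ∈ H'^χ` with `P z = ϖ^e y`; `z` is primitive.
    obtain ⟨n, hn⟩ : ∃ n, e = n + 1 := ⟨e - 1, by omega⟩
    have hmin : ¬∀ y : Y, ∃ x ∈ X₂, P x = ϖ ^ n • y := hemin n (by omega)
    push Not at hmin
    obtain ⟨y, hy⟩ := hmin
    obtain ⟨z, hzX, hPz⟩ := he y
    have hzprim : ∀ z' : H', z ≠ ϖ • z' := by
      intro z' hzz'
      have hz'X : z' ∈ X₂ := hXsat 1 z' (by rw [pow_one, ← hzz']; exact hzX)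
      refine hy z' hz'X (smul_right_injective Y hϖ0 ?_)
      dsimp only
      rw [← map_smul, ← hzz', hPz, hn, pow_succ', mul_smul]
    -- `τ^•` has torsion cokernel: `τ l = ϖ^M z` with `l ≠ 0`, `l = ϖ^i ω̃₀`, `ω̃₀` primitive.
    obtain ⟨M, l, hl⟩ := hτ z hzX
    have hl0 : l ≠ 0 := by
      rintro rfl
      rw [map_zero, eq_comm, smul_eq_zero_iff_right (pow_ne_zero M hϖ0)] at hl
      exact hzprim 0 (by rw [hl, smul_zero])
    obtain ⟨i, ω₀, rfl, hω₀⟩ := exists_eq_pow_smul_primitive hϖ hl0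
    rw [map_smul] at hl
    have hiM : i ≤ M := le_of_pow_smul_eq_pow_smul_of_primitive hϖ0 hzprim hl.symm
    have hτω₀ : τ ω₀ = ϖ ^ (M - i) • z := eq_pow_sub_smul_of_pow_smul_eq hϖ0 hiM hl
    have hk : M - i ≤ B + 2 * u := bound ω₀ z y (M - i) hω₀ hτω₀ hPz
    -- (EqFinalClaim) + Conrad + primitivity of `z`: `c ≤ B + (M - i)`.
    obtain ⟨h, hh⟩ := hcomb ω₀
    rw [hτω₀, map_smul] at hh
    rcases le_or_gt c (M - i) with hck | hck
    · omega
    have h1 : j z = ϖ ^ (c - (M - i)) • h := eq_pow_sub_smul_of_pow_smul_eq hϖ0 hck.le hh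
    obtain ⟨h', hh'⟩ := exists_pow_smul_eq_of_coker j hj hB h1
    have := le_of_pow_smul_eq_pow_smul_of_primitive hϖ0 hzprim hh'
    omega

end OldCase

end Literature.NumberTheory.Automorphic.ManinValuation
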